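import Summits.BirchSwinnertonDyer.BirchSwinnertonDyer.Theorems.GenusKolyvaginAtTwoShaCardDvdPowAtTwoPosTDefectSizing
import HarnessLib

/-!
# Route `GenusKolyvaginAtTwo`, residual `OffCutResidualAtTwo` (stmt-BirchSwinnertonDyer-25503), pen LINE 24 «strict_def2», stub X⁼²
# (upper half of `KolyvaginExactAtTwoPosDiscT` at Tamagawa defect 2): THE ONE-BIT LAW —
# on a `2`-Selmer-minimal twin `σ_* = id` on `Ш(E/K)[2^∞]`, `2·Ш(E/K)[2^∞] ⊆ res Ш(E/ℚ)[2^∞]`, hence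
# `#Ш(E/K)[2^∞] ≤ #Ш(E/K)[2] · #res Ш(E/ℚ)[2^∞]` — NO budget, NO relaxed index, sign-free, defect-free

Seat `bsd-line-gk2-p4` g27 (WIDTH-5 attach, cell `bsd-f1-sign2`), `--supports stmt-BirchSwinnertonDyer-25503` (helper; closes nothing).
THEOREMS ONLY (no definition, no named fact, no `sorry`); standard axioms.  **BSD is NOT proved by this file; X⁼² / LINE 24 / 25503 are
NOT proved; no item is closed.**  Companion memo: evidence #13 on 25503 (`X2-DEF2-ONEBIT-gk2p4-g27.md`).

WHY.  gk2-p3 g28's sizing (`…PosTDefectSizing`): the pair sandwich with the archimedean-bit budget `A·A′ ≤ 4^(d+1)` reaches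
`#Ш(E/K)[2^∞] ∣ 4^(M₀+d)` at defect `d`; the pen's card v1.1 §P1 then proposed the budget B⁼²_A «`A·A′ ≤ 4` in case A (`ρ_q = 2`)».  The memo
shows (Kramer 1981 Thm. 1 + corestriction + Fisher 2003 Prop. 2.16) that on that cell `#X = 4·#Y` EXACTLY, so `A = 8`, B⁼²_A is false, and the
last bit is `ℚ`-SIDE.  This file types the structural half of that count (`X = Ш(E/K)[2^∞]`, `Y = Ш(E/ℚ)[2^∞]`, `T = W.quadraticTwist (discr K)`,
`res = resBaseChange`, `cor = corBaseChange`, `τ_* = (isLiftOfAut_liftAut σ).conjH1Points`):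

* §1 `conjH1Points_eq_self_of_shaPrimary` — **`σ_* = id` on `Ш(E/K)[2^∞]` whenever `Ш(T/ℚ)[2^∞] = 0`**: `x − τ_* x = ψ_*(res′(cor′ ψ_*⁻¹ x))`
  (the sign rule `h1Equiv_twistIso_conjH1Points` + `res′∘cor′ = 1 + τ′_*`, LEAD gk2-p1 g19's (A)-mechanism) and `cor′ ψ_*⁻¹ x ∈ Ш(T/ℚ)[2^∞] = 0`.
  INPUT displayed as the binder `hcorT`: `cor′` maps `Ш(T_K/K)` into `Ш(T/ℚ)` (the local double-coset compatibility of corestriction — PRINT,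
  Neukirch–Schmidt–Wingberg I.§5 / Fisher 2003 proof of Prop. 2.16 — recorded as `-- TODO(general form)` in `Literature…ShaCorestrictionIndexTwo`).
* §2 `two_nsmul_mem_map_resBaseChange_of_shaPrimary` — hence `2x = x + τ_* x = res(cor x)` and, with the same input `hcorE` for `E`,
  **`2·X ⊆ res(Y)`**; `natCard_shaPrimary_le_torsionBy_mul_natCard_map_res` — **`#X ≤ #Ш(E/K)[2] · #res(Y)`** (`#X = #ker(2|_X) · #2X`);
  `natCard_shaPrimary_le_torsionBy_mul_natCard` — **`#X ≤ #Ш(E/K)[2] · #Y`**; and with a non-zero class of `Y` killed by `res` (the Kramer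
  class lies in `Ш(E/ℚ)` — Kramer's `Φ ≠ 0`, the K₄/K₄⁺ cells): `two_mul_natCard_shaPrimary_le_of_kramerClass_mem` — **`2·#X ≤ #Ш(E/K)[2] · #Y`**.
* §3 `natCard_shaPrimary_dvd_pow_succ_of_exponent` — with the B2Q-shape exponent (`2^(M₀)·Y = 0`), `#Ш(E/ℚ)[2] ≤ 4` and `#Ш(E/K)[2] ≤ 4`
  (one Kolyvagin–McCallum block): **`#Ш(E/K)[2^∞] ∣ 4^(M₀+1)` at ANY Tamagawa defect** (one bit short of X⁼²'s upper half; the sandwich: `d` bits);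
  `natCard_shaPrimary_dvd_pow_of_exponent_of_kramerClass_mem` — and **`∣ 4^(M₀)`** when the Kramer class lies in `Ш(E/ℚ)` (the budget-free
  form of U_T′/U⁺_T′'s upper halves).
* §4 `natCard_primaryComponent_sha_baseChange_two_dvd_pow_succ_of_defect_of_cor` — on gk2-p3 g28's frame of `…PosTDefectSizing` §3 VERBATIM
  (habitat `W`, cut datum, `w = +1`, `rank E(ℚ) = 0`, `#Sel₂(E) ∣ 4`, elliptic twin with `#Sel₂(Wd) = 2` and `ord₂ C(Wd) = d`, exponent `m`) plus
  `hcorE`/`hcorT` and `#Ш(E/K)[2] ≤ 4`: **`#Ш(E/K)[2^∞] ∣ 4^(m+1)` for EVERY `d`** (g28: `4^(m+d)`); the defect enters only the finiteness of `Ш(E/K)[2^∞]`.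
READING (memo §2–§4).  With Cassels–Tate res/cor adjointness (`Literature…casselsTate_pairing_resCor`, Fisher 2003 Prop. 2.16) the inequality
of §2 is an identity on one-block cells: `#X = 4·#Y` iff the Kramer class is NOT in `Ш(E/ℚ)` (Kramer's `Φ = Sel₂(E) ∩ Sel₂(E^d) = 0`: the
DEF-2 case-A cell of LINE 24), `#X = #Y` iff it is (K₄, K₄⁺).  So X⁼²'s upper half `#X ∣ 4^(M₀)` is, on case A, EQUIVALENT to
`#Ш(E/ℚ)[2^∞] ∣ 4^(M₀−1)` — one bit below Kolyvagin's B₂ over `ℚ` (`two_pow_M0_smul_eq_zero_of_mem_sha_rat_signFree`), i.e. Kolyvagin's own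
K-side bound `#Ш(E/K)[2^∞] ≤ 4^(m₀)` at `p = 2` on a cell where the `ℚ`-side road is provably one bit short: beyond print.  Nothing here proves it.

References: [Kramer1981] Thm. 1, §2 Prop. 3, 6, 7, Thm. 2; [Fisher2003] Prop. 2.16; [GrossLMS1991] §5; [SerreGaloisCohomology1997] I §2.4 Prop. 9;
[MilneADT2006] I Rem. 3.7, Thm. 6.13; [Kolyvagin1989Izv] Thm. B₂; [McCallumLMS1991] §5 Cor. 5.6; [SilvermanAEC2009] X.4.14.
-/

set_option autoImplicit false
set_option linter.dupNamespace false -- `Summit.<P>.<Sub>` repeats `BirchSwinnertonDyer` (D-0017)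

noncomputable section

open scoped Classical

namespace Summit.BirchSwinnertonDyer.BirchSwinnertonDyer.Theorems.GenusExact.PlusDescent.OneBit

open Literature.NumberTheory.EllipticCurves Literature.NumberTheory.GaloisRepresentations WeierstrassCurve NumberField
  IsDedekindDomain Field AddSubgroup
open Summit.BirchSwinnertonDyer.BirchSwinnertonDyer.Theorems.GenusExact.PlusDescent
open Summit.BirchSwinnertonDyer.BirchSwinnertonDyer.Theorems.GenusExact.SelmerDescent (mem_comap_resBaseChange_shaPrimary_iff
  two_nsmul_eq_zero_of_resBaseChange_eq_zero)

variable (W : WeierstrassCurve ℚ) (K : Type) [Field K] [NumberField K]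

/-! ## §1 `σ_* = id` on `Ш(E/K)[2^∞]` for a twin with `Ш(T/ℚ)[2^∞] = 0` -/

/-- **`σ_* = id` on `Ш(E/K)[2^∞]` when the twin has `Ш(T/ℚ)[2^∞] = 0`.**  `E = W/ℚ`, `K` imaginary quadratic, `σ ≠ 1`,
`T = W.quadraticTwist (discr K)`; inputs: `Ш(T/ℚ)[2^∞] = 0` and the corestriction compatibility `cor′(Ш(T_K/K)) ⊆ Ш(T/ℚ)` (binder `hcorT`).
For `x ∈ Ш(E_K/K)` of `2`-power order: `x − τ_* x = ψ_*(res′(cor′(ψ_*⁻¹ x)))` (sign rule + `res′ ∘ cor′ = 1 + τ′_*`), and `cor′(ψ_*⁻¹ x)` is a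
`2`-power-torsion element of `Ш(T/ℚ)`, i.e. `0`.  [cite: Kramer1981, Thm. 1] [cite: GrossLMS1991, §5 (5.1)] [cite: SerreGaloisCohomology1997, I §2.4 Prop. 9] -/
theorem conjH1Points_eq_self_of_shaPrimary (hIQ : IsImaginaryQuadratic K) {σ : K ≃ₐ[ℚ] K} (hσ1 : σ ≠ 1)
    (hT0 : ∀ x ∈ AddCommGroup.primaryComponent (↥(W.quadraticTwist (NumberField.discr K : ℚ)).sha) 2, x = 0)
    (hcorT : ∀ c : ((W.quadraticTwist (NumberField.discr K : ℚ)).baseChange K).galH1,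
        c ∈ ((W.quadraticTwist (NumberField.discr K : ℚ)).baseChange K).sha →
          corBaseChange K (W.quadraticTwist (NumberField.discr K : ℚ)) σ hIQ.1 hσ1 c ∈ (W.quadraticTwist (NumberField.discr K : ℚ)).sha)
    (x : (W.baseChange K).galH1) (hx : x ∈ (W.baseChange K).sha) (hk : ∃ k : ℕ, 2 ^ k • x = 0) :
    (isLiftOfAut_liftAut σ).conjH1Points W x = x := by
  haveI : Fact (Nat.Prime 2) := ⟨Nat.prime_two⟩
  have h2 : Module.finrank ℚ K = 2 := hIQ.1
  obtain ⟨τ, θ₀, hτ1, hθ₀Q, hθ₀, hτθ₀, hall⟩ := exists_gal_ne_one_sqrt_discr K h2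
  obtain rfl : σ = τ := (hall σ).resolve_left hσ1
  obtain ⟨C, hC⟩ := W.exists_variableChange_quadraticTwist_one
  set T := W.quadraticTwist (NumberField.discr K : ℚ) with hTdef
  set Φ := h1Equiv (twistIso W hθ₀Q hθ₀ hC) (twistIso_smul W hθ₀Q hθ₀ hC) with hΦ
  set cor' := corBaseChange K T σ h2 hσ1 with hcor'
  set res' := resBaseChange T K with hres'
  -- `s := ψ_*⁻¹ x ∈ Ш(T_K)` of `2`-power order
  set s := Φ.symm x with hs
  have hxs : Φ s = x := by rw [hs, AddEquiv.apply_symm_apply]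
  have hssha : s ∈ (T.baseChange K).sha := by
    rw [mem_sha_iff_h1Equiv_twistIso_mem W hθ₀Q hθ₀ hC, ← hΦ, hxs]
    exact hx
  obtain ⟨k, hk⟩ := hk
  have hsk : 2 ^ k • s = 0 := by
    apply Φ.injective
    rw [map_nsmul, hxs, hk, map_zero]
  -- `cor' s` is a `2`-power-torsion element of `Ш(T/ℚ)`, hence `0`
  have hcs : cor' s = 0 := by
    have hmem : cor' s ∈ T.sha := hcorT s hssha
    have hprim : (⟨cor' s, hmem⟩ : ↥T.sha) ∈ AddCommGroup.primaryComponent (↥T.sha) 2 := by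
      apply (AddCommGroup.mem_primaryComponent).mpr
      refine ⟨k, Subtype.ext ?_⟩
      rw [AddSubgroupClass.coe_nsmul, ZeroMemClass.coe_zero, ← map_nsmul, hsk, map_zero]
    have h := hT0 _ hprim
    exact congrArg Subtype.val h
  -- the key identity `x - τ_* x = ψ_*(res'(cor' s))`
  have hkey : Φ (res' (cor' s)) = x - (isLiftOfAut_liftAut σ).conjH1Points W x := by
    rw [hres', hcor', resBaseChange_corBaseChange K T σ h2 hσ1 (isLiftOfAut_liftAut σ) s, map_add, hΦ,
      h1Equiv_twistIso_conjH1Points W hθ₀Q hθ₀ hC (isLiftOfAut_liftAut σ) hτθ₀ s, ← hΦ, hxs, sub_eq_add_neg]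
  rw [hcs, map_zero, map_zero] at hkey
  exact (sub_eq_zero.mp hkey.symm).symm

/-! ## §2 `2·Ш(E/K)[2^∞] ⊆ res Ш(E/ℚ)[2^∞]` and the count `#Ш(E/K)[2^∞] ≤ #Ш(E/K)[2] · #res Ш(E/ℚ)[2^∞]` -/

/-- **`2x = res(cor x) ∈ res(Ш(E/ℚ)[2^∞])` for `x ∈ Ш(E/K)[2^∞]`** on a twin with `Ш(T/ℚ)[2^∞] = 0` (inputs `hcorT`, `hcorE`: corestriction
maps `Ш` to `Ш` for `T` and for `E`): `res(cor x) = x + τ_* x` (`resBaseChange_corBaseChange`) `= 2x` (§1), and `cor x ∈ Ш(E/ℚ)` has `2`-power order.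
[cite: SerreGaloisCohomology1997, I §2.4 Prop. 9] [cite: Kramer1981, Thm. 1] -/
theorem two_nsmul_mem_map_resBaseChange_of_shaPrimary (hIQ : IsImaginaryQuadratic K) {σ : K ≃ₐ[ℚ] K} (hσ1 : σ ≠ 1)
    (hT0 : ∀ x ∈ AddCommGroup.primaryComponent (↥(W.quadraticTwist (NumberField.discr K : ℚ)).sha) 2, x = 0)
    (hcorT : ∀ c : ((W.quadraticTwist (NumberField.discr K : ℚ)).baseChange K).galH1,
        c ∈ ((W.quadraticTwist (NumberField.discr K : ℚ)).baseChange K).sha →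
          corBaseChange K (W.quadraticTwist (NumberField.discr K : ℚ)) σ hIQ.1 hσ1 c ∈ (W.quadraticTwist (NumberField.discr K : ℚ)).sha)
    (hcorE : ∀ c : (W.baseChange K).galH1, c ∈ (W.baseChange K).sha → corBaseChange K W σ hIQ.1 hσ1 c ∈ W.sha)
    (x : (W.baseChange K).galH1) (hx : x ∈ (W.baseChange K).sha) (hk : ∃ k : ℕ, 2 ^ k • x = 0) :
    2 • x ∈ ((AddCommGroup.primaryComponent (↥W.sha) 2).map W.sha.subtype).map (resBaseChange W K) := by
  haveI : Fact (Nat.Prime 2) := ⟨Nat.prime_two⟩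
  have h2 : Module.finrank ℚ K = 2 := hIQ.1
  have hfix := conjH1Points_eq_self_of_shaPrimary W K hIQ hσ1 hT0 hcorT x hx hk
  obtain ⟨k, hk⟩ := hk
  have hres : resBaseChange W K (corBaseChange K W σ h2 hσ1 x) = 2 • x := by
    rw [resBaseChange_corBaseChange K W σ h2 hσ1 (isLiftOfAut_liftAut σ) x, hfix, two_nsmul]
  have hmem : corBaseChange K W σ h2 hσ1 x ∈ W.sha := hcorE x hx
  refine AddSubgroup.mem_map.mpr ⟨corBaseChange K W σ h2 hσ1 x, ?_, hres⟩
  refine AddSubgroup.mem_map.mpr ⟨⟨corBaseChange K W σ h2 hσ1 x, hmem⟩, ?_, rfl⟩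
  apply (AddCommGroup.mem_primaryComponent).mpr
  refine ⟨k, Subtype.ext ?_⟩
  rw [AddSubgroupClass.coe_nsmul, ZeroMemClass.coe_zero, ← map_nsmul, hk, map_zero]

/-- **`#Ш(E/K)[2^∞] ≤ #Ш(E/K)[2] · #res(Ш(E/ℚ)[2^∞])`** on a twin with `Ш(T/ℚ)[2^∞] = 0` (inputs `hcorT`, `hcorE`), both `2`-primary parts
finite: `#X = #ker(2·|_X) · #(2·X)`, the kernel embeds into `Ш(E/K)[2]`, and `2·X ⊆ res(Y)` (`two_nsmul_mem_map_resBaseChange_of_shaPrimary`).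
NO budget, NO relaxed index, NO sign or defect hypothesis.  [cite: Kramer1981, Thm. 1] [cite: GrossLMS1991, §5 (5.1)–(5.3)] -/
theorem natCard_shaPrimary_le_torsionBy_mul_natCard_map_res (hIQ : IsImaginaryQuadratic K) {σ : K ≃ₐ[ℚ] K} (hσ1 : σ ≠ 1)
    [Finite (AddCommGroup.primaryComponent (↥W.sha) 2)] [Finite (AddCommGroup.primaryComponent (↥(W.baseChange K).sha) 2)]
    (hT0 : ∀ x ∈ AddCommGroup.primaryComponent (↥(W.quadraticTwist (NumberField.discr K : ℚ)).sha) 2, x = 0)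
    (hcorT : ∀ c : ((W.quadraticTwist (NumberField.discr K : ℚ)).baseChange K).galH1,
        c ∈ ((W.quadraticTwist (NumberField.discr K : ℚ)).baseChange K).sha →
          corBaseChange K (W.quadraticTwist (NumberField.discr K : ℚ)) σ hIQ.1 hσ1 c ∈ (W.quadraticTwist (NumberField.discr K : ℚ)).sha)
    (hcorE : ∀ c : (W.baseChange K).galH1, c ∈ (W.baseChange K).sha → corBaseChange K W σ hIQ.1 hσ1 c ∈ W.sha) :
    Nat.card (AddCommGroup.primaryComponent (↥(W.baseChange K).sha) 2) ≤
      Nat.card (AddSubgroup.torsionBy (↥(W.baseChange K).sha) ((2 : ℕ) : ℤ)) *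
        Nat.card (((AddCommGroup.primaryComponent (↥W.sha) 2).map W.sha.subtype).map (resBaseChange W K)) := by
  haveI : Fact (Nat.Prime 2) := ⟨Nat.prime_two⟩
  set X : AddSubgroup ↥(W.baseChange K).sha := AddCommGroup.primaryComponent (↥(W.baseChange K).sha) 2 with hX
  set Xs : AddSubgroup (W.baseChange K).galH1 := X.map (W.baseChange K).sha.subtype with hXs
  set Y : AddSubgroup ↥W.sha := AddCommGroup.primaryComponent (↥W.sha) 2 with hY
  set Ys : AddSubgroup W.galH1 := Y.map W.sha.subtype with hYs
  set res := resBaseChange W K with hres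
  -- multiplication by `2` on `H¹(K, E_K)`
  set f : (W.baseChange K).galH1 →+ (W.baseChange K).galH1 := AddMonoidHom.id _ + AddMonoidHom.id _ with hf
  have hfapp : ∀ z, f z = 2 • z := fun z ↦ by rw [hf, AddMonoidHom.add_apply, AddMonoidHom.id_apply, two_nsmul]
  -- members of `Xs`
  have hXsmem : ∀ z ∈ Xs, z ∈ (W.baseChange K).sha ∧ ∃ k : ℕ, 2 ^ k • z = 0 := by
    intro z hz
    obtain ⟨x', hx', rfl⟩ := AddSubgroup.mem_map.mp hz
    obtain ⟨k, hk⟩ := (AddCommGroup.mem_primaryComponent).mp hx'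
    exact ⟨x'.2, k, by rw [AddSubgroup.coe_subtype, ← AddSubgroupClass.coe_nsmul, hk, ZeroMemClass.coe_zero]⟩
  -- `#Xs = #ker(f|Xs) · #f(Xs)`
  have hsplit := natCard_eq_natCard_ker_mul_natCard_map Xs f
  -- the kernel embeds into `Ш(E/K)[2]` (finite: inside `X`)
  haveI hX2fin : Finite (AddSubgroup.torsionBy (↥(W.baseChange K).sha) ((2 : ℕ) : ℤ)) := by
    refine Finite.of_injective (fun z : AddSubgroup.torsionBy (↥(W.baseChange K).sha) ((2 : ℕ) : ℤ) ↦
      (⟨(z : ↥(W.baseChange K).sha), (AddCommGroup.mem_primaryComponent).mpr ⟨1, ?_⟩⟩ : X)) ?_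
    · rw [pow_one]; exact AddSubgroup.torsionBy.nsmul_iff.mp z.2
    · intro z₁ z₂ h
      exact Subtype.ext (congrArg (fun x : X ↦ (x : ↥(W.baseChange K).sha)) h)
  have hker : Nat.card (f.comp Xs.subtype).ker ≤ Nat.card (AddSubgroup.torsionBy (↥(W.baseChange K).sha) ((2 : ℕ) : ℤ)) := by
    refine Nat.card_le_card_of_injective
      (fun k : (f.comp Xs.subtype).ker ↦ (⟨⟨((k : Xs) : (W.baseChange K).galH1), (hXsmem _ (k : Xs).2).1⟩,
        AddSubgroup.torsionBy.nsmul_iff.mpr ?_⟩ : AddSubgroup.torsionBy (↥(W.baseChange K).sha) ((2 : ℕ) : ℤ))) ?_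
    · have hk := (AddMonoidHom.mem_ker).mp k.2
      rw [AddMonoidHom.comp_apply, AddSubgroup.coe_subtype, hfapp] at hk
      exact Subtype.ext (by rw [AddSubgroupClass.coe_nsmul, ZeroMemClass.coe_zero]; exact hk)
    · intro k₁ k₂ h
      have h' := congrArg (fun z : AddSubgroup.torsionBy (↥(W.baseChange K).sha) ((2 : ℕ) : ℤ) ↦ ((z : ↥(W.baseChange K).sha) : (W.baseChange K).galH1)) h
      exact Subtype.ext (Subtype.ext h')
  -- the image lies in `res(Ys)`
  have hmaple : Xs.map f ≤ Ys.map res := by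
    rintro _ ⟨z, hz, rfl⟩
    rw [hfapp]
    obtain ⟨hzsha, hzk⟩ := hXsmem z hz
    exact two_nsmul_mem_map_resBaseChange_of_shaPrimary W K hIQ hσ1 hT0 hcorT hcorE z hzsha hzk
  haveI hYsfin : Finite Ys :=
    Finite.of_equiv _ (Y.equivMapOfInjective W.sha.subtype W.sha.subtype_injective).toEquiv
  haveI hmapfin : Finite (Ys.map res) := by
    have h : ((Ys.map res : AddSubgroup (W.baseChange K).galH1) : Set (W.baseChange K).galH1).Finite := by
      rw [AddSubgroup.coe_map]; exact (Set.toFinite _).image _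
    exact h.to_subtype
  have hmap : Nat.card (Xs.map f) ≤ Nat.card (Ys.map res) := AddSubgroup.card_le_of_le hmaple
  have hcardXs : Nat.card Xs = Nat.card X :=
    (Nat.card_congr (X.equivMapOfInjective (W.baseChange K).sha.subtype (W.baseChange K).sha.subtype_injective).toEquiv).symm
  calc Nat.card X = Nat.card Xs := hcardXs.symm
    _ = Nat.card (f.comp Xs.subtype).ker * Nat.card (Xs.map f) := hsplit
    _ ≤ _ := Nat.mul_le_mul hker hmap

/-- **`#Ш(E/K)[2^∞] ≤ #Ш(E/K)[2] · #Ш(E/ℚ)[2^∞]`** on a twin with `Ш(T/ℚ)[2^∞] = 0` (inputs `hcorT`, `hcorE`), both `2`-primary parts finite.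
[cite: Kramer1981, Thm. 1] [cite: GrossLMS1991, §5 (5.1)–(5.3)] -/
theorem natCard_shaPrimary_le_torsionBy_mul_natCard (hIQ : IsImaginaryQuadratic K) {σ : K ≃ₐ[ℚ] K} (hσ1 : σ ≠ 1)
    [Finite (AddCommGroup.primaryComponent (↥W.sha) 2)] [Finite (AddCommGroup.primaryComponent (↥(W.baseChange K).sha) 2)]
    (hT0 : ∀ x ∈ AddCommGroup.primaryComponent (↥(W.quadraticTwist (NumberField.discr K : ℚ)).sha) 2, x = 0)
    (hcorT : ∀ c : ((W.quadraticTwist (NumberField.discr K : ℚ)).baseChange K).galH1,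
        c ∈ ((W.quadraticTwist (NumberField.discr K : ℚ)).baseChange K).sha →
          corBaseChange K (W.quadraticTwist (NumberField.discr K : ℚ)) σ hIQ.1 hσ1 c ∈ (W.quadraticTwist (NumberField.discr K : ℚ)).sha)
    (hcorE : ∀ c : (W.baseChange K).galH1, c ∈ (W.baseChange K).sha → corBaseChange K W σ hIQ.1 hσ1 c ∈ W.sha) :
    Nat.card (AddCommGroup.primaryComponent (↥(W.baseChange K).sha) 2) ≤
      Nat.card (AddSubgroup.torsionBy (↥(W.baseChange K).sha) ((2 : ℕ) : ℤ)) * Nat.card (AddCommGroup.primaryComponent (↥W.sha) 2) := by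
  set Y : AddSubgroup ↥W.sha := AddCommGroup.primaryComponent (↥W.sha) 2 with hY
  set Ys : AddSubgroup W.galH1 := Y.map W.sha.subtype with hYs
  haveI hYsfin : Finite Ys := Finite.of_equiv _ (Y.equivMapOfInjective W.sha.subtype W.sha.subtype_injective).toEquiv
  have hcardYs : Nat.card Ys = Nat.card Y := (Nat.card_congr (Y.equivMapOfInjective W.sha.subtype W.sha.subtype_injective).toEquiv).symm
  have hle : Nat.card (Ys.map (resBaseChange W K)) ≤ Nat.card Y := by
    rw [← hcardYs, natCard_eq_natCard_ker_mul_natCard_map Ys (resBaseChange W K)]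
    exact Nat.le_mul_of_pos_left _ Nat.card_pos
  exact (natCard_shaPrimary_le_torsionBy_mul_natCard_map_res W K hIQ hσ1 hT0 hcorT hcorE).trans (Nat.mul_le_mul_left _ hle)

/-- **`2·#Ш(E/K)[2^∞] ≤ #Ш(E/K)[2] · #Ш(E/ℚ)[2^∞]` when some non-zero class of `Ш(E/ℚ)[2^∞]` dies in `Ш(E/K)`** (the Kramer class lies in
`Ш(E/ℚ)`, i.e. Kramer's `Φ = Sel₂(E) ∩ Sel₂(E^d) ≠ 0` — the K₄/K₄⁺ cells): then `#res(Y) ≤ #Y/2`.  [cite: Kramer1981, Thm. 1, Prop. 7] -/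
theorem two_mul_natCard_shaPrimary_le_of_kramerClass_mem (hIQ : IsImaginaryQuadratic K) {σ : K ≃ₐ[ℚ] K} (hσ1 : σ ≠ 1)
    [Finite (AddCommGroup.primaryComponent (↥W.sha) 2)] [Finite (AddCommGroup.primaryComponent (↥(W.baseChange K).sha) 2)]
    (hT0 : ∀ x ∈ AddCommGroup.primaryComponent (↥(W.quadraticTwist (NumberField.discr K : ℚ)).sha) 2, x = 0)
    (hcorT : ∀ c : ((W.quadraticTwist (NumberField.discr K : ℚ)).baseChange K).galH1,
        c ∈ ((W.quadraticTwist (NumberField.discr K : ℚ)).baseChange K).sha →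
          corBaseChange K (W.quadraticTwist (NumberField.discr K : ℚ)) σ hIQ.1 hσ1 c ∈ (W.quadraticTwist (NumberField.discr K : ℚ)).sha)
    (hcorE : ∀ c : (W.baseChange K).galH1, c ∈ (W.baseChange K).sha → corBaseChange K W σ hIQ.1 hσ1 c ∈ W.sha)
    (hKr : ∃ η : W.galH1, η ∈ (AddCommGroup.primaryComponent (↥W.sha) 2).map W.sha.subtype ∧ η ≠ 0 ∧ resBaseChange W K η = 0) :
    2 * Nat.card (AddCommGroup.primaryComponent (↥(W.baseChange K).sha) 2) ≤
      Nat.card (AddSubgroup.torsionBy (↥(W.baseChange K).sha) ((2 : ℕ) : ℤ)) * Nat.card (AddCommGroup.primaryComponent (↥W.sha) 2) := by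
  set Y : AddSubgroup ↥W.sha := AddCommGroup.primaryComponent (↥W.sha) 2 with hY
  set Ys : AddSubgroup W.galH1 := Y.map W.sha.subtype with hYs
  set res := resBaseChange W K with hres
  haveI hYsfin : Finite Ys := Finite.of_equiv _ (Y.equivMapOfInjective W.sha.subtype W.sha.subtype_injective).toEquiv
  have hcardYs : Nat.card Ys = Nat.card Y := (Nat.card_congr (Y.equivMapOfInjective W.sha.subtype W.sha.subtype_injective).toEquiv).symm
  -- `#Ys = #ker(res|Ys) · #res(Ys)` with `#ker ≥ 2`
  have hsplit := natCard_eq_natCard_ker_mul_natCard_map Ys res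
  obtain ⟨η, hηY, hη0, hηres⟩ := hKr
  have hker2 : 2 ≤ Nat.card (res.comp Ys.subtype).ker := by
    haveI : Finite (res.comp Ys.subtype).ker := inferInstance
    have hnt : Nontrivial (res.comp Ys.subtype).ker := by
      refine ⟨⟨⟨⟨η, hηY⟩, (AddMonoidHom.mem_ker).mpr ?_⟩, 0, fun h ↦ hη0 ?_⟩⟩
      · change res ((⟨η, hηY⟩ : Ys) : W.galH1) = 0
        exact hηres
      · exact congrArg (fun z : (res.comp Ys.subtype).ker ↦ ((z : Ys) : W.galH1)) h
    exact Finite.one_lt_card_iff_nontrivial.mpr hnt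
  have hmapY : 2 * Nat.card (Ys.map res) ≤ Nat.card Y := by
    calc 2 * Nat.card (Ys.map res) ≤ Nat.card (res.comp Ys.subtype).ker * Nat.card (Ys.map res) := Nat.mul_le_mul_right _ hker2
      _ = Nat.card Ys := hsplit.symm
      _ = Nat.card Y := hcardYs
  have h := natCard_shaPrimary_le_torsionBy_mul_natCard_map_res W K hIQ hσ1 hT0 hcorT hcorE
  calc 2 * Nat.card (AddCommGroup.primaryComponent (↥(W.baseChange K).sha) 2)
      ≤ 2 * (Nat.card (AddSubgroup.torsionBy (↥(W.baseChange K).sha) ((2 : ℕ) : ℤ)) * Nat.card (Ys.map res)) := Nat.mul_le_mul_left 2 h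
    _ = Nat.card (AddSubgroup.torsionBy (↥(W.baseChange K).sha) ((2 : ℕ) : ℤ)) * (2 * Nat.card (Ys.map res)) := by ring
    _ ≤ _ := Nat.mul_le_mul_left _ hmapY

/-! ## §3 With the `ℚ`-side exponent: `#Ш(E/K)[2^∞] ∣ 4^(M₀+1)` at any defect (one block), `∣ 4^(M₀)` when the Kramer class is in `Ш(E/ℚ)` -/

variable [W.IsElliptic]

omit [W.IsElliptic] in
/-- Filtration count: `2^(M₀)·Ш(E/ℚ)[2^∞] = 0` and `#Ш(E/ℚ)[2] ≤ 4` give `#Ш(E/ℚ)[2^∞] ≤ 4^(M₀)` (`#Y ≤ #Y[2]^(M₀)`). [cite: Fuchs1970, §8 Thm. 8.4] -/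
theorem natCard_shaPrimary_rat_le_pow [Finite (AddCommGroup.primaryComponent (↥W.sha) 2)] {M₀ : ℕ}
    (hexp : ∀ a ∈ AddCommGroup.primaryComponent (↥W.sha) 2, 2 ^ M₀ • a = 0)
    (h4 : Nat.card (AddSubgroup.torsionBy (↥W.sha) ((2 : ℕ) : ℤ)) ≤ 4) :
    Nat.card (AddCommGroup.primaryComponent (↥W.sha) 2) ≤ 4 ^ M₀ := by
  haveI : Fact (Nat.Prime 2) := ⟨Nat.prime_two⟩
  have h := natCard_le_natCard_torsionBy_pow (A := AddCommGroup.primaryComponent (↥W.sha) 2) 2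
    (fun x ↦ Subtype.ext (by rw [AddSubgroupClass.coe_nsmul, ZeroMemClass.coe_zero]; exact hexp x x.2))
  have hbr := CasselsTateNumberField.natCard_sha_torsionBy_pow_eq_primaryComponent W 2 1
  rw [pow_one] at hbr
  rw [← hbr] at h
  exact h.trans (Nat.pow_le_pow_left h4 M₀)

/-- `#Ш(E/K)[2^∞] = 4^t` (Cassels–Tate over `K`, unconditional in the tree). [cite: SilvermanAEC2009, Thm. X.4.14] -/
theorem exists_natCard_shaPrimary_baseChange_eq_pow [Finite (AddCommGroup.primaryComponent (↥(W.baseChange K).sha) 2)] :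
    ∃ t : ℕ, Nat.card (AddCommGroup.primaryComponent (↥(W.baseChange K).sha) 2) = 2 ^ (2 * t) := by
  haveI : Fact (Nat.Prime 2) := ⟨Nat.prime_two⟩
  haveI hell : (W.baseChange K).IsElliptic := inferInstanceAs ((W.map (algebraMap ℚ K)).IsElliptic)
  obtain ⟨e, he⟩ := exists_natCard_addPrimaryComponent_eq_pow (A := ↥(W.baseChange K).sha) 2
  obtain ⟨r, hr⟩ := CasselsTateNumberField.isSquare_natCard_primaryComponent_sha (W.baseChange K) 2
  have hr2 : r * r = 2 ^ e := by rw [← hr, he]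
  obtain ⟨t, -, rfl⟩ := (Nat.dvd_prime_pow Nat.prime_two).mp (⟨r, hr2.symm⟩ : r ∣ 2 ^ e)
  exact ⟨t, by rw [hr, ← pow_add, two_mul]⟩

/-- **`#Ш(E/K)[2^∞] ∣ 4^(M₀+1)` at ANY Tamagawa defect** from: a twin with `Ш(T/ℚ)[2^∞] = 0`, the inputs `hcorT`/`hcorE`, the `ℚ`-side
exponent `2^(M₀)·Ш(E/ℚ)[2^∞] = 0` (B2Q-shape, DISPLAYED), `#Ш(E/ℚ)[2] ≤ 4` (RANKQ-shape) and `#Ш(E/K)[2] ≤ 4` (one Kolyvagin–McCallum block):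
`#X ≤ 4 · #Y ≤ 4 · 4^(M₀)` (§2 + filtration count) and `#X = 4^t` (Cassels–Tate over `K`, unconditional in the tree).  One bit short of X⁼²'s
upper half; the remaining bit is `ℚ`-side (memo §4).  [cite: Kolyvagin1989Izv, Thm. B₂] [cite: Kramer1981, Thm. 1] [cite: McCallumLMS1991, §5 Cor. 5.6]
[cite: SilvermanAEC2009, Thm. X.4.14] -/
theorem natCard_shaPrimary_dvd_pow_succ_of_exponent (hIQ : IsImaginaryQuadratic K) {σ : K ≃ₐ[ℚ] K} (hσ1 : σ ≠ 1)
    [Finite (AddCommGroup.primaryComponent (↥W.sha) 2)] [Finite (AddCommGroup.primaryComponent (↥(W.baseChange K).sha) 2)]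
    (hT0 : ∀ x ∈ AddCommGroup.primaryComponent (↥(W.quadraticTwist (NumberField.discr K : ℚ)).sha) 2, x = 0)
    (hcorT : ∀ c : ((W.quadraticTwist (NumberField.discr K : ℚ)).baseChange K).galH1,
        c ∈ ((W.quadraticTwist (NumberField.discr K : ℚ)).baseChange K).sha →
          corBaseChange K (W.quadraticTwist (NumberField.discr K : ℚ)) σ hIQ.1 hσ1 c ∈ (W.quadraticTwist (NumberField.discr K : ℚ)).sha)
    (hcorE : ∀ c : (W.baseChange K).galH1, c ∈ (W.baseChange K).sha → corBaseChange K W σ hIQ.1 hσ1 c ∈ W.sha)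
    {M₀ : ℕ} (hexp : ∀ a ∈ AddCommGroup.primaryComponent (↥W.sha) 2, 2 ^ M₀ • a = 0)
    (h4 : Nat.card (AddSubgroup.torsionBy (↥W.sha) ((2 : ℕ) : ℤ)) ≤ 4)
    (hX4 : Nat.card (AddSubgroup.torsionBy (↥(W.baseChange K).sha) ((2 : ℕ) : ℤ)) ≤ 4) :
    Nat.card (AddCommGroup.primaryComponent (↥(W.baseChange K).sha) 2) ∣ 2 ^ (2 * (M₀ + 1)) := by
  have hX : Nat.card (AddCommGroup.primaryComponent (↥(W.baseChange K).sha) 2) ≤ 4 * 4 ^ M₀ :=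
    (natCard_shaPrimary_le_torsionBy_mul_natCard W K hIQ hσ1 hT0 hcorT hcorE).trans
      (Nat.mul_le_mul hX4 (natCard_shaPrimary_rat_le_pow W hexp h4))
  obtain ⟨t, ht⟩ := exists_natCard_shaPrimary_baseChange_eq_pow W K
  rw [ht] at hX ⊢
  have hX' : 2 ^ (2 * t) ≤ 2 ^ (2 * (M₀ + 1)) := by
    calc 2 ^ (2 * t) ≤ 4 * 4 ^ M₀ := hX
      _ = 2 ^ (2 * (M₀ + 1)) := by
          rw [show (4 : ℕ) = 2 ^ 2 by norm_num, ← pow_mul, ← pow_add]; ring_nf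
  exact Nat.pow_dvd_pow 2 ((Nat.pow_le_pow_iff_right (by norm_num)).mp hX')

/-- **`#Ш(E/K)[2^∞] ∣ 4^(M₀)` — the budget-free form of the upper half** when, in addition, a non-zero class of `Ш(E/ℚ)[2^∞]` dies in
`Ш(E/K)` (the Kramer class lies in `Ш(E/ℚ)`; Kramer's `Φ ≠ 0`, automatic on the one-block cells with `Σ i_v = 1`: K₄, K₄⁺): `2·#X ≤ 4·#Y ≤ 4^(M₀+1)`,
`#X = 4^t` ⟹ `t ≤ M₀`.  [cite: Kolyvagin1989Izv, Thm. B₂] [cite: Kramer1981, Thm. 1, Prop. 7] [cite: McCallumLMS1991, §5 Cor. 5.6] -/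
theorem natCard_shaPrimary_dvd_pow_of_exponent_of_kramerClass_mem (hIQ : IsImaginaryQuadratic K) {σ : K ≃ₐ[ℚ] K} (hσ1 : σ ≠ 1)
    [Finite (AddCommGroup.primaryComponent (↥W.sha) 2)] [Finite (AddCommGroup.primaryComponent (↥(W.baseChange K).sha) 2)]
    (hT0 : ∀ x ∈ AddCommGroup.primaryComponent (↥(W.quadraticTwist (NumberField.discr K : ℚ)).sha) 2, x = 0)
    (hcorT : ∀ c : ((W.quadraticTwist (NumberField.discr K : ℚ)).baseChange K).galH1,
        c ∈ ((W.quadraticTwist (NumberField.discr K : ℚ)).baseChange K).sha →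
          corBaseChange K (W.quadraticTwist (NumberField.discr K : ℚ)) σ hIQ.1 hσ1 c ∈ (W.quadraticTwist (NumberField.discr K : ℚ)).sha)
    (hcorE : ∀ c : (W.baseChange K).galH1, c ∈ (W.baseChange K).sha → corBaseChange K W σ hIQ.1 hσ1 c ∈ W.sha)
    (hKr : ∃ η : W.galH1, η ∈ (AddCommGroup.primaryComponent (↥W.sha) 2).map W.sha.subtype ∧ η ≠ 0 ∧ resBaseChange W K η = 0)
    {M₀ : ℕ} (hexp : ∀ a ∈ AddCommGroup.primaryComponent (↥W.sha) 2, 2 ^ M₀ • a = 0)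
    (h4 : Nat.card (AddSubgroup.torsionBy (↥W.sha) ((2 : ℕ) : ℤ)) ≤ 4)
    (hX4 : Nat.card (AddSubgroup.torsionBy (↥(W.baseChange K).sha) ((2 : ℕ) : ℤ)) ≤ 4) :
    Nat.card (AddCommGroup.primaryComponent (↥(W.baseChange K).sha) 2) ∣ 2 ^ (2 * M₀) := by
  have hX : 2 * Nat.card (AddCommGroup.primaryComponent (↥(W.baseChange K).sha) 2) ≤ 4 * 4 ^ M₀ :=
    (two_mul_natCard_shaPrimary_le_of_kramerClass_mem W K hIQ hσ1 hT0 hcorT hcorE hKr).trans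
      (Nat.mul_le_mul hX4 (natCard_shaPrimary_rat_le_pow W hexp h4))
  obtain ⟨t, ht⟩ := exists_natCard_shaPrimary_baseChange_eq_pow W K
  rw [ht] at hX ⊢
  have hX' : 2 ^ (2 * t + 1) ≤ 2 ^ (2 * M₀ + 2) := by
    calc 2 ^ (2 * t + 1) = 2 * 2 ^ (2 * t) := by ring
      _ ≤ 4 * 4 ^ M₀ := hX
      _ = 2 ^ (2 * M₀ + 2) := by
          rw [show (4 : ℕ) = 2 ^ 2 by norm_num, ← pow_mul, ← pow_add]; ring_nf
  have htM : 2 * t + 1 ≤ 2 * M₀ + 2 := (Nat.pow_le_pow_iff_right (by norm_num)).mp hX'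
  exact Nat.pow_dvd_pow 2 (by omega)

/-! ## §4 On the cut's frame (any sign of `Δ`, ANY Tamagawa defect): `#Ш(E/K)[2^∞] ∣ 4^(m+1)` -/

section Frame

variable [W.IsGloballyMinimal] [NeZero (W.conductorNorm ℤ)]

/-- **THE UPPER HALF UP TO ONE BIT AT ANY TAMAGAWA DEFECT.**  gk2-p3 g28's frame of `…PosTDefectSizing` §3 VERBATIM (habitat `W`, cut datum with
`2^(M+1) ∤ P(1)`, `w(E) = +1`, `rank E(ℚ) = 0`, `#Sel₂(E) ∣ 4`, elliptic twin `Wd` with `#Sel₂(Wd) = 2`, `ord₂ C(Wd) = d`, exponent `m` DISPLAYED), plus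
the corestriction binders `hcorE`, `hcorT` (every `σ ≠ 1`) and ONE Kolyvagin–McCallum block over `K` (`#Ш(E/K)[2] ≤ 4`): **`#Ш(E/K)[2^∞] ∣ 4^(m+1)`**,
independent of `d` (the sandwich: `4^(m+d)`); `d` enters only the finiteness of `Ш(E/K)[2^∞]`.  [cite: Kramer1981, Thm. 1, §2 Prop. 3]
[cite: GrossLMS1991, §5 Prop. 5.3] [cite: Kolyvagin1989Izv, Thm. B₂] [cite: McCallumLMS1991, §5 Cor. 5.6] -/
theorem natCard_primaryComponent_sha_baseChange_two_dvd_pow_succ_of_defect_of_cor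
    (hT : Odd W.tamagawaProduct) (hIQ : IsImaginaryQuadratic K) (hodd : Odd (NumberField.discr K))
    (hHe : SatisfiesHeegnerHypothesis (W.conductorNorm ℤ) K) (hs2 : W.HasSurjectiveModNGaloisRep 2)
    (Dt : Literature.NumberTheory.EllipticCurves.ModularForms.ModularParametrizationData W (W.conductorNorm ℤ)) (β : ℤ) (ι : K →+* ℂ)
    (d₁ : KolyvaginHeegnerData Dt β ι 1) (hy : ¬ IsOfFinAddOrder d₁.derivedPoint) (M : ℕ)
    (hndiv : ¬ ∃ Q : (W.baseChange (ringClassField K ι 1)).toAffine.Point, ((2 ^ (M + 1) : ℕ) : ℤ) • Q = d₁.derivedPoint)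
    (hw : W.rootNumber = 1) (hrk0 : W.mordellWeilRank = 0) (hSel4 : Nat.card (W.selmerGroup 2) ∣ 4)
    (Wd : WeierstrassCurve ℚ) [Wd.IsElliptic] (hWd : ∃ C : VariableChange ℚ, C • W.quadraticTwist (NumberField.discr K : ℚ) = Wd)
    (hSel : Nat.card (Wd.selmerGroup 2) = 2) {d : ℕ} (hDEF : padicValNat 2 Wd.tamagawaProduct = d)
    {m : ℕ} (hB2Q : ∀ (k : ℕ) (a : W.galH1), a ∈ W.sha → ((2 ^ k : ℕ) : ℤ) • a = 0 → ((2 ^ m : ℕ) : ℤ) • a = 0)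
    (hcorT : ∀ (σ : K ≃ₐ[ℚ] K) (hσ1 : σ ≠ 1), ∀ c : ((W.quadraticTwist (NumberField.discr K : ℚ)).baseChange K).galH1,
        c ∈ ((W.quadraticTwist (NumberField.discr K : ℚ)).baseChange K).sha →
          corBaseChange K (W.quadraticTwist (NumberField.discr K : ℚ)) σ hIQ.1 hσ1 c ∈ (W.quadraticTwist (NumberField.discr K : ℚ)).sha)
    (hcorE : ∀ (σ : K ≃ₐ[ℚ] K) (hσ1 : σ ≠ 1), ∀ c : (W.baseChange K).galH1, c ∈ (W.baseChange K).sha → corBaseChange K W σ hIQ.1 hσ1 c ∈ W.sha)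
    (hX4 : Nat.card (AddSubgroup.torsionBy (↥(W.baseChange K).sha) ((2 : ℕ) : ℤ)) ≤ 4) :
    Nat.card (AddCommGroup.primaryComponent (W.baseChange K).sha 2) ∣ 2 ^ (2 * (m + 1)) := by
  haveI : Fact (Nat.Prime 2) := ⟨Nat.prime_two⟩
  have hdK : (NumberField.discr K : ℚ) ≠ 0 := by exact_mod_cast NumberField.discr_ne_zero K
  haveI hTell : (W.quadraticTwist (NumberField.discr K : ℚ)).IsElliptic := W.isElliptic_quadraticTwist hdK
  obtain ⟨τ, hτ, -⟩ := exists_conj_of_isImaginaryQuadratic (K := K) hIQ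
  obtain ⟨h2tors, hrk, ⟨yK, hndiv', hanti⟩, hT0⟩ :=
    exists_frame_of_cut W K hIQ hHe hs2 hτ Dt β ι d₁ hy M hndiv hw hrk0 Wd hWd hSel
  have hexp := forall_primaryComponent_sha_two_pow_smul_eq_zero_of_galH1 W hB2Q
  haveI := finite_primaryComponent_sha_rat_two_of_exponent W hexp
  obtain ⟨Cd, hCd⟩ := hWd
  obtain ⟨hne, hneT, -⟩ := DefectSizing.relIndex_mul_relIndex_le_pow_of_padicValNat_eq W K hIQ hodd hHe hT Cd hCd hDEF
  -- `Ш(T/ℚ)[2^∞] = 0` is finite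
  haveI hfinT : Finite (AddCommGroup.primaryComponent (↥(W.quadraticTwist (NumberField.discr K : ℚ)).sha) 2) :=
    @Finite.of_subsingleton _ ⟨fun a b ↦ Subtype.ext (by rw [hT0 a.1 a.2, hT0 b.1 b.2])⟩
  -- `Ш(E/K)[2^∞]` is finite (pair sandwich, frame + the two `ℚ`-sides)
  haveI hXfin : Finite (AddCommGroup.primaryComponent (↥(W.baseChange K).sha) 2) :=
    (finite_and_two_mul_natCard_sha_le_pair_of_frame W K hIQ hτ h2tors hrk yK M hndiv' hanti hfinT hne hneT).1
  -- `#Ш(E/ℚ)[2] ≤ #Sel₂(E/ℚ) ≤ 4`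
  have h4 : Nat.card (AddSubgroup.torsionBy (↥W.sha) ((2 : ℕ) : ℤ)) ≤ 4 := by
    have h := natCard_sha_torsionBy_dvd_natCard_selmerGroup W (n := 2) two_ne_zero
    simp only [Nat.cast_ofNat] at h
    have h' : Nat.card (AddSubgroup.torsionBy W.sha (2 : ℤ)) ∣ 4 := h.trans hSel4
    exact Nat.le_of_dvd (by norm_num) (by simpa using h')
  exact natCard_shaPrimary_dvd_pow_succ_of_exponent W K hIQ hτ hT0 (hcorT τ hτ) (hcorE τ hτ) hexp h4 hX4

end Frame

end Summit.BirchSwinnertonDyer.BirchSwinnertonDyer.Theorems.GenusExact.PlusDescent.OneBit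

end
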